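import Literature.Computability.QuantumComplexity.OracleCoinLayout
import HarnessLib

/-!
# Uniform oracle coin simulation, III: the classical run of the simulating circuit

Third file of the `OCoin` discharge of `uniformOracleCoinSimulation` (`CoinFamilyKernel.lean`;
layout and program in `OracleCoinLayout.lean`). Relative to an oracle language `A`, the classical
part `body` acts on basis states by `OSim.ocEval A` (`OCoin.Dc_mulVec_basisState`); this file
computes that action on the initial content `x y 0…0` round by round:

* the **physical answer slots** `slotFn t` after `t` rounds (round `t` XORs, for every `ℓ ≤ R`,
  the oracle's answer on the first `ℓ` bits of the padded query of round `t` of the replay against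
  the current slots into slot `(t, ℓ)`), the slot string `ansL t`, the slot function
  `σP t = OSim.slotσ (ansL t) R` and the block's word `word t = OSim.wordσ M ⟨x, y⟩ (σP t) R R`;
  `σP_genuine` / `outσ_σP`: the slots of the genuine query lengths hold the genuine answers, so the
  last word ends with the genuine output (the argument of `OSim.sigmaSeq_genuine` /
  `OSim.outσ_sigmaSeq`, rerun for the physical slots, which may differ from `OSim.sigmaSeq` in
  slots that are never read along the genuine run);
* the **invariant** `St t w` (data wires = `x y (ansL t)`, block work wires clear, windows of the
  rounds `≥ t` clear) and **one round** (`st_roundOps`): block (`clEval_blkC`, the block with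
  suffix on an arbitrary assignment), copy of query field `t` into window `t`, block again (frame
  rule `clEval_ite` and the involution `RevClean.clEval_cleanOps_cleanOps`), the `R + 1` queries
  (`ocEval_orcT`);
* the **finale**: the last block leaves the word on the result wires, the swaps bring its output
  cells to the front (`RevMux.clEval_swapOps`): `out_prefix` — the genuine output of `M` on
  `⟨x, y⟩` is a prefix of the read-out — and `out_injective` (the coins are never overwritten and
  sit at known wires at the end).

## References

* E. Bernstein, U. Vazirani, *Quantum complexity theory*, SIAM J. Comput. 26 (1997) 1411–1473,
  Thm. 8.3 (proof) and §8.3 (oracle QTMs: "its final state will be `|f(x)⟩`, just as in a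
  classical oracle machine") [BernsteinVazirani1997SICOMP].
* C. H. Bennett, E. Bernstein, G. Brassard, U. Vazirani, SIAM J. Comput. 26 (1997) 1510–1523, §2
  [BennettBernsteinBrassardVazirani1997].
* M. A. Nielsen, I. L. Chuang, *Quantum Computation and Quantum Information*, CUP 2010, §3.2.5,
  §6.1.1 [NielsenChuang2010].
-/

noncomputable section

namespace Literature.Computability.QuantumComplexity

namespace OCoin

open _root_.Computability Complexity Complexity.PRelSigma Cryptography RevSim RevClean RazTalMachine Matrix Turing
  Function

variable (P : Params) {n : ℕ} (x : QReg n) (y : QReg (qn P n)) (A : Language Bool)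

/-! ### The physical answer slots -/

section Slots

/-- The pairing `⟨x, y⟩` on which the oracle algorithm is run. [folklore] -/
def xin : List Bool := boolPair (List.ofFn x) (List.ofFn y)

/-- `|⟨x, y⟩| = 2n + 2 + q(n)`. [folklore] -/
theorem length_xin : (xin P x y).length = nx P n := by simp [xin, nx]

/-- `R = r(|⟨x, y⟩|)`. [folklore] -/
theorem RR_eq : P.r.eval (xin P x y).length = RR P n := by rw [length_xin]; rfl

/-- **The physical answer slots after `t` rounds** (slot `(s, ℓ)` at index `s (R+1) + ℓ`): round
`t` sets slot `(t, ℓ)`, `ℓ ≤ R`, to the oracle's answer on the first `ℓ` bits of the padded query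
of round `t` of the replay against the current slots. [cite: BernsteinVazirani1997SICOMP, Thm. 8.3 (proof) with §8.3] -/
def slotFn : ℕ → ℕ → Bool
  | 0 => fun _ => false
  | t + 1 => fun k =>
    if t * (RR P n + 1) ≤ k ∧ k ≤ t * (RR P n + 1) + RR P n then
      A.boolIndicator ((OSim.padTo (RR P n) (OSim.qryσ P.M (xin P x y)
        (OSim.slotσ (List.ofFn fun j : Fin (SS P n) => slotFn t j) (RR P n)) t)).take (k - t * (RR P n + 1)))
    else slotFn t k

/-- The slot string after `t` rounds (`SS = R (R+1)` bits). [folklore] -/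
def ansL (t : ℕ) : List Bool := List.ofFn fun k : Fin (SS P n) => slotFn P x y A t k

/-- The slot function after `t` rounds, as read by the replay (`OSim.slotσ`). [folklore] -/
def σP (t : ℕ) : ℕ → ℕ → Bool := OSim.slotσ (ansL P x y A t) (RR P n)

/-- **The word written by the block after `t` rounds**: the `R` padded queries of the replay
against the slots, then its output. [cite: BernsteinVazirani1997SICOMP, Thm. 8.3 (proof)] -/
def word (t : ℕ) : List Bool := OSim.wordσ P.M (xin P x y) (σP P x y A t) (RR P n) (RR P n)

/-- `|ansL t| = SS`. [folklore] -/
@[simp] theorem length_ansL (t : ℕ) : (ansL P x y A t).length = SS P n := by simp [ansL]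

/-- `getD` of `List.ofFn`. [folklore] -/
theorem getD_ofFn {m : ℕ} (f : Fin m → Bool) (i : ℕ) :
    (List.ofFn f).getD i false = if h : i < m then f ⟨i, h⟩ else false := by
  split_ifs with h
  · rw [List.getD_eq_getElem _ _ (by simpa using h), List.getElem_ofFn]
  · rw [List.getD_eq_default _ _ (by simpa using h)]

/-- Bits of the slot string. [folklore] -/
theorem getD_ansL (t k : ℕ) : (ansL P x y A t).getD k false = if k < SS P n then slotFn P x y A t k else false := by
  rw [ansL, getD_ofFn]; split_ifs <;> rfl

/-- The slot function, unfolded. [folklore] -/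
theorem σP_apply (t s ℓ : ℕ) :
    σP P x y A t s ℓ = if s * (RR P n + 1) + ℓ < SS P n then slotFn P x y A t (s * (RR P n + 1) + ℓ) else false := by
  rw [σP, OSim.slotσ, getD_ansL]

/-- One more round of slots, unfolded. [folklore] -/
theorem slotFn_succ (t k : ℕ) : slotFn P x y A (t + 1) k =
    if t * (RR P n + 1) ≤ k ∧ k ≤ t * (RR P n + 1) + RR P n then
      A.boolIndicator ((OSim.padTo (RR P n) (OSim.qryσ P.M (xin P x y) (σP P x y A t) t)).take (k - t * (RR P n + 1)))
    else slotFn P x y A t k := by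
  rw [slotFn]; rfl

/-- The slot written in round `t` at length `ℓ ≤ R`. [folklore] -/
theorem slotFn_succ_round (t : ℕ) {ℓ : ℕ} (hℓ : ℓ ≤ RR P n) : slotFn P x y A (t + 1) (t * (RR P n + 1) + ℓ) =
    A.boolIndicator ((OSim.padTo (RR P n) (OSim.qryσ P.M (xin P x y) (σP P x y A t) t)).take ℓ) := by
  rw [slotFn_succ, if_pos ⟨Nat.le_add_right _ _, by omega⟩, Nat.add_sub_cancel_left]

/-- Slots outside round `t` are not written in round `t`. [folklore] -/
theorem slotFn_succ_of_not (t : ℕ) {k : ℕ} (hk : ¬ (t * (RR P n + 1) ≤ k ∧ k ≤ t * (RR P n + 1) + RR P n)) :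
    slotFn P x y A (t + 1) k = slotFn P x y A t k := by
  rw [slotFn_succ, if_neg hk]

/-- Slots of the rounds not yet played are clear. [folklore] -/
theorem slotFn_of_le : ∀ (t : ℕ) {k : ℕ} (_ : t * (RR P n + 1) ≤ k), slotFn P x y A t k = false
  | 0, _, _ => rfl
  | t + 1, k, hk => by
    rw [slotFn_succ_of_not P x y A t (fun h => by rw [Nat.succ_mul] at hk; omega)]
    exact slotFn_of_le t (le_trans (Nat.mul_le_mul_right _ (Nat.le_succ t)) hk)

/-- Slots of the rounds already played are not rewritten. [folklore] -/
theorem slotFn_stable {t : ℕ} : ∀ {t' : ℕ} (_ : t ≤ t') {k : ℕ} (_ : k < t * (RR P n + 1)),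
    slotFn P x y A t' k = slotFn P x y A t k
  | 0, h, k, _ => by
    obtain rfl : t = 0 := Nat.le_zero.1 h
    rfl
  | t' + 1, h, k, hk => by
    rcases Nat.eq_or_lt_of_le h with rfl | hlt
    · rfl
    · have ht' : t ≤ t' := Nat.lt_succ_iff.1 hlt
      have hmul : t * (RR P n + 1) ≤ t' * (RR P n + 1) := Nat.mul_le_mul_right _ ht'
      rw [slotFn_succ_of_not P x y A t' (fun hh => by omega), slotFn_stable ht' hk]

/-- Slot indices of rounds `s < R` and lengths `ℓ ≤ R` are inside the slot string. [folklore] -/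
theorem slot_lt_SS {s ℓ : ℕ} (hs : s < RR P n) (hℓ : ℓ ≤ RR P n) : s * (RR P n + 1) + ℓ < SS P n := by
  unfold SS; nlinarith

/-- **The slots of the genuine query lengths hold the genuine answers** (for the rounds played in
which the genuine run `OSim.gq` asks a short query). [cite: BernsteinVazirani1997SICOMP, Thm. 8.3 (proof) with §8.3] -/
theorem σP_genuine {m : ℕ} (hmR : m ≤ RR P n) (hQ : ∀ s < m, (OSim.gq P.M (xin P x y) A s).length ≤ RR P n) :
    ∀ (t s : ℕ), s < t → s < m →
      σP P x y A t s (OSim.gq P.M (xin P x y) A s).length = A.boolIndicator (OSim.gq P.M (xin P x y) A s)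
  | 0, _, hs, _ => absurd hs (Nat.not_lt_zero _)
  | t + 1, s, hst, hsm => by
    have hsR : s < RR P n := lt_of_lt_of_le hsm hmR
    have hidx := slot_lt_SS P hsR (hQ s hsm)
    rw [σP_apply, if_pos hidx]
    rcases Nat.lt_succ_iff_lt_or_eq.1 hst with hst' | rfl
    · have ih := σP_genuine hmR hQ t s hst' hsm
      rw [σP_apply, if_pos hidx] at ih
      have hk : s * (RR P n + 1) + (OSim.gq P.M (xin P x y) A s).length < t * (RR P n + 1) := by
        have h1 : (s + 1) * (RR P n + 1) ≤ t * (RR P n + 1) := Nat.mul_le_mul_right _ hst'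
        have h2 := hQ s hsm
        rw [Nat.succ_mul] at h1; omega
      rw [slotFn_stable P x y A (Nat.le_succ t) hk, ih]
    · rw [slotFn_succ_round P x y A s (hQ s hsm),
        OSim.qryσ_eq_gq (k := s) (fun s' hs' => σP_genuine hmR hQ s s' hs' (by omega)) le_rfl,
        OSim.take_length_padTo (hQ s hsm)]

/-- **After `R` rounds the replay against the physical slots outputs the genuine output.**
[cite: BernsteinVazirani1997SICOMP, Thm. 8.3 (proof) with §8.3] -/
theorem outσ_σP {m : ℕ} {b : List Bool} (hrun : OSim.RunShape P.M A (xin P x y) m b) (hmR : m < RR P n)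
    (hQ : ∀ s < m, (OSim.gq P.M (xin P x y) A s).length ≤ RR P n) :
    OSim.outσ P.M (xin P x y) (σP P x y A (RR P n)) (RR P n) = some b :=
  OSim.firstOut_eq hrun (OSim.asσ_eq_answerBits fun s hs => σP_genuine P x y A (le_of_lt hmR) hQ (RR P n) s (by omega) hs)
    (RR P n) 0 (Nat.zero_le _) (by omega)

/-- **The last word ends with the genuine output**: `word R = fields ++ b`. [cite: BernsteinVazirani1997SICOMP, Thm. 8.3 (proof) with §8.3] -/
theorem word_RR {m : ℕ} {b : List Bool} (hrun : OSim.RunShape P.M A (xin P x y) m b) (hmR : m < RR P n)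
    (hQ : ∀ s < m, (OSim.gq P.M (xin P x y) A s).length ≤ RR P n) :
    word P x y A (RR P n) = OSim.fieldsσ P.M (xin P x y) (σP P x y A (RR P n)) (RR P n) (RR P n) ++ b := by
  rw [word, OSim.wordσ, outσ_σP P x y A hrun hmR hQ]; rfl

/-- The word has at least `R²` bits (the fields). [folklore] -/
theorem sq_le_length_word (t : ℕ) : RR P n * RR P n ≤ (word P x y A t).length := by
  rw [word, OSim.length_wordσ]; exact Nat.le_add_right _ _

/-- **Bit `sR + i` of the word is bit `i` of the padded query of round `s`.** [folklore] -/
theorem getD_word_field (t : ℕ) {s i : ℕ} (hs : s < RR P n) (hi : i < RR P n) :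
    (word P x y A t).getD (s * RR P n + i) false =
      (OSim.padTo (RR P n) (OSim.qryσ P.M (xin P x y) (σP P x y A t) s)).getD i false :=
  OSim.getD_wordσ_field P.M (xin P x y) _ hs hi

end Slots

/-! ### The data wires -/

section Data

/-- The content of data wire `i` after `t` rounds: input, coins, slots. [folklore] -/
def dFn (t i : ℕ) : Bool :=
  if i < n + qn P n then (List.ofFn x ++ List.ofFn y).getD i false else slotFn P x y A t (i - (n + qn P n))

/-- The data string after `t` rounds. [folklore] -/
def dL (t : ℕ) : List Bool := List.ofFn x ++ List.ofFn y ++ ansL P x y A t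

/-- `|dL t| = DD`. [folklore] -/
@[simp] theorem length_dL (t : ℕ) : (dL P x y A t).length = DD P n := by simp [dL, DD, Nat.add_assoc]

/-- Bits of the data string. [folklore] -/
theorem getD_dL {t i : ℕ} (hi : i < DD P n) : (dL P x y A t).getD i false = dFn P x y A t i := by
  unfold dL dFn
  have hl : (List.ofFn x ++ List.ofFn y).length = n + qn P n := by simp
  by_cases h : i < n + qn P n
  · rw [if_pos h, List.getD_append _ _ _ _ (by rw [hl]; exact h)]
  · rw [if_neg h, List.getD_append_right _ _ _ _ (by rw [hl]; omega), hl, getD_ansL, if_pos]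
    unfold DD at hi; omega

/-- **The block function on the data string**: the word. [cite: BernsteinVazirani1997SICOMP, Thm. 8.3 (proof) with §8.3] -/
theorem simFn_dL (t : ℕ) : simFn P.M P.r P.q (dL P x y A t ++ CWrap.vg n) = word P x y A t := by
  have e : P.r.eval (boolPair (List.ofFn x) (List.ofFn y)).length = RR P n := RR_eq P x y
  have h := simFn_eq_wordσ (M := P.M) (r := P.r) (q := P.q) (n := n) (List.ofFn x) (List.ofFn y) (ansL P x y A t)
    (by simp) (by simp) (by rw [e, length_ansL]; rfl)
  rw [dL, h, e]; rfl

/-- Data wires below the slots hold input and coins, whatever the round. [folklore] -/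
theorem dFn_of_lt {i : ℕ} (hi : i < n + qn P n) (t : ℕ) : dFn P x y A t i = (List.ofFn x ++ List.ofFn y).getD i false := by
  rw [dFn, if_pos hi]

/-- The slot wires hold the slots. [folklore] -/
theorem dFn_slotW (t s ℓ : ℕ) : dFn P x y A t (slotW P n s ℓ) = slotFn P x y A t (s * (RR P n + 1) + ℓ) := by
  rw [dFn, slotW_eq, if_neg (by omega), Nat.add_sub_cancel_left]

/-- A data wire at or above the slots base, as a slot index. [folklore] -/
theorem dFn_of_le {i : ℕ} (hi : n + qn P n ≤ i) (t : ℕ) : dFn P x y A t i = slotFn P x y A t (i - (n + qn P n)) := by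
  rw [dFn, if_neg (not_lt.2 hi)]

end Data

/-! ### The block on an arbitrary assignment -/

section Block

/-- **The block with suffix on an assignment holding a data string `d` and clear work wires**:
afterwards the data are unchanged, the work wires hold the read-out of the block function's value
on `d ++ vg n`, and nothing beyond the block width has changed. [cite: NielsenChuang2010, §3.2.5 (garbage-free computation)] -/
theorem clEval_blkC (d : List Bool) (hd : d.length = DD P n) (w : ℕ → Bool)
    (h1 : ∀ i < DD P n, w i = d.getD i false) (h2 : ∀ i, DD P n ≤ i → i < Wblk P n → w i = false) :
    clEval (blkC P n) w = fun i =>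
      if i < Wblk P n then
        (if i < DD P n then d.getD i false else readOut P.e P.Mtm (nT P n) (simFn P.M P.r P.q (d ++ CWrap.vg n)) i)
      else w i := by
  have hM' : P.Mtm.OutputsWithin (d ++ CWrap.vg n) (simFn P.M P.r P.q (d ++ CWrap.vg n))
      (Tn P.e (d.length + (CWrap.vg n).length)) := by
    have := P.hM (d ++ CWrap.vg n); rwa [List.length_append] at this
  have hcan := clEval_cleanOps (e := P.e) (M := P.Mtm) d (CWrap.vg n) _ hM'
  rw [hd] at hcan
  change clEval (blkC P n) (strW d) = fun i => if i < DD P n then d.getD i false else readOut P.e P.Mtm (nT P n) _ i at hcan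
  have hagree : ∀ i, i < Wblk P n → w i = strW d i := by
    intro i hi
    by_cases hid : i < DD P n
    · rw [h1 i hid]; rfl
    · rw [h2 i (not_lt.1 hid) hi, strW, List.getD_eq_default _ _ (by rw [hd]; exact not_lt.1 hid)]
  funext i
  by_cases hi : i < Wblk P n
  · rw [if_pos hi, clEval_agree (fun i => i < Wblk P n) _ (blkC_lt_Wblk P n) hagree i hi, hcan]
  · rw [if_neg hi]
    exact clEval_apply_of_forall_target_ne _ _ fun op hop heq =>
      hi (heq ▸ blkC_lt_Wblk P n op hop op.target (by simp [wiresOf]))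

/-- **The block run twice is the identity.** [cite: NielsenChuang2010, §3.2.5 (eq. (3.7))] -/
theorem clEval_blkC_blkC (w : ℕ → Bool) : clEval (blkC P n) (clEval (blkC P n) w) = w :=
  clEval_cleanOps_cleanOps _ _ w

/-- **Frame**: the block commutes with changes at and above its width. [folklore] -/
theorem clEval_blkC_ite (g w : ℕ → Bool) :
    clEval (blkC P n) (fun i => if Wblk P n ≤ i then g i else w i) =
      fun i => if Wblk P n ≤ i then g i else clEval (blkC P n) w i :=
  clEval_ite (fun i => Wblk P n ≤ i) _ (fun op hop =>
    ⟨fun h => absurd (blkC_lt_Wblk P n op hop op.target (by simp [wiresOf])) (not_lt.2 h),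
      fun c hc h => absurd (blkC_lt_Wblk P n op hop c (by simp [wiresOf, hc])) (not_lt.2 h)⟩) g w

/-- The machine on a block content, with the time bound at the tableau input length. [folklore] -/
theorem hM_nT (d : List Bool) (hd : d.length = DD P n) :
    P.Mtm.OutputsWithin (d ++ CWrap.vg n) (simFn P.M P.r P.q (d ++ CWrap.vg n)) (Tn P.e (nT P n)) := by
  have h := P.hM (d ++ CWrap.vg n)
  rw [List.length_append, hd] at h
  exact h

/-- The length of a block content is the tableau input length. [folklore] -/
theorem length_append_vg (d : List Bool) (hd : d.length = DD P n) : (d ++ CWrap.vg n).length = nT P n := by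
  rw [List.length_append, hd]; rfl

/-- The output word fits: `|simFn (d ++ vg n)| < JJ`. [folklore] -/
theorem length_simFn_lt_JJ (d : List Bool) (hd : d.length = DD P n) :
    (simFn P.M P.r P.q (d ++ CWrap.vg n)).length < JJ P.e P.Mtm (nT P n) :=
  (length_lt_JJ_of_outputsWithin (e := P.e) (length_append_vg P d hd) (hM_nT P d hd)).1

/-- **The `true`-code result wire of a cell inside the word reads that bit of the word.**
[folklore] -/
theorem readOut_fW (d : List Bool) (hd : d.length = DD P n) {k : ℕ} (hk : k < (simFn P.M P.r P.q (d ++ CWrap.vg n)).length) :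
    readOut P.e P.Mtm (nT P n) (simFn P.M P.r P.q (d ++ CWrap.vg n)) (fW P n k) =
      (simFn P.M P.r P.q (d ++ CWrap.vg n))[k] := by
  rw [fW, readOut_resW (lt_trans hk (length_simFn_lt_JJ P d hd)),
    CWrap.outBit_symTrue_eq (e := P.e) (length_append_vg P d hd) (hM_nT P d hd) hk]

end Block

/-! ### Semantics of the queries of a round -/

section Queries

/-- **A list of queries with pairwise distinct answer wires, none of which is a query wire**: an
answer wire receives the XOR with the oracle's answer on its query wires (read in the initial
assignment), every other wire is unchanged. [cite: BernsteinVazirani1997SICOMP, §8.3 (p. 1455)] -/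
theorem ocEval_oracles (qs : ℕ → List ℕ) (tg : ℕ → ℕ) :
    ∀ (L : List ℕ) (_ : (L.map tg).Nodup) (_ : ∀ a ∈ L, ∀ b ∈ L, tg a ∉ qs b) (w : ℕ → Bool),
      (∀ a ∈ L, OSim.ocEval A (L.map fun a => RtOp.oracle (qs a) (tg a)) w (tg a) =
          (w (tg a) ^^ A.boolIndicator ((qs a).map w))) ∧
        ∀ i, (∀ a ∈ L, tg a ≠ i) → OSim.ocEval A (L.map fun a => RtOp.oracle (qs a) (tg a)) w i = w i
  | [], _, _, w => by simp
  | a :: L, hnd, hdis, w => by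
    rw [List.map_cons, List.nodup_cons] at hnd
    have hdis' : ∀ a' ∈ L, ∀ b ∈ L, tg a' ∉ qs b := fun a' ha' b hb =>
      hdis a' (List.mem_cons_of_mem _ ha') b (List.mem_cons_of_mem _ hb)
    set w' := OSim.ocAct A (RtOp.oracle (qs a) (tg a)) w with hw'
    obtain ⟨ih1, ih2⟩ := ocEval_oracles qs tg L hnd.2 hdis' w'
    have hstep : OSim.ocEval A ((a :: L).map fun a => RtOp.oracle (qs a) (tg a)) w =
        OSim.ocEval A (L.map fun a => RtOp.oracle (qs a) (tg a)) w' := by rw [List.map_cons, OSim.ocEval_cons]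
    have hw'a : w' (tg a) = (w (tg a) ^^ A.boolIndicator ((qs a).map w)) := by simp [hw', OSim.ocAct]
    have hw'ne : ∀ i, i ≠ tg a → w' i = w i := fun i hi => by simp [hw', OSim.ocAct, update_of_ne hi]
    have hread : ∀ b ∈ a :: L, (qs b).map w' = (qs b).map w := fun b hb =>
      List.map_congr_left fun j hj => hw'ne j fun e => hdis a (by simp) b hb (e ▸ hj)
    have hnota : ∀ a' ∈ L, tg a' ≠ tg a := fun a' ha' he => hnd.1 (by rw [← he]; exact List.mem_map_of_mem ha')
    refine ⟨fun b hb => ?_, fun i hi => ?_⟩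
    · rw [hstep]
      rcases List.mem_cons.1 hb with rfl | hb'
      · rw [ih2 (tg b) hnota, hw'a]
      · rw [ih1 b hb', hread b hb, hw'ne _ (hnota b hb')]
    · rw [hstep, ih2 i (fun a' ha' => hi a' (List.mem_cons_of_mem _ ha')), hw'ne i (Ne.symm (hi a (by simp)))]

/-- **The queries of round `t`**: slot `(t, ℓ)`, `ℓ ≤ R`, receives the XOR with the oracle's
answer on the first `ℓ` wires of window `t`; nothing else changes. [cite: BernsteinVazirani1997SICOMP, §8.3 (p. 1455)] -/
theorem ocEval_orcT {t : ℕ} (ht : t < RR P n) (w : ℕ → Bool) :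
    (∀ ℓ ≤ RR P n, OSim.ocEval A (orcT P n t) w (slotW P n t ℓ) =
        (w (slotW P n t ℓ) ^^ A.boolIndicator ((List.range ℓ).map fun i => w (winW P n t i)))) ∧
      ∀ i, (∀ ℓ ≤ RR P n, i ≠ slotW P n t ℓ) → OSim.ocEval A (orcT P n t) w i = w i := by
  have hnd : ((List.range (RR P n + 1)).map (slotW P n t)).Nodup := by
    refine List.nodup_range.map_on fun a ha b hb h => ?_
    exact (slotW_inj P n (Nat.lt_succ_iff.1 (List.mem_range.1 ha)) (Nat.lt_succ_iff.1 (List.mem_range.1 hb)) h).2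
  have hdis : ∀ a ∈ List.range (RR P n + 1), ∀ b ∈ List.range (RR P n + 1), slotW P n t a ∉ qry P n t b := by
    intro a ha b _ hmem
    obtain ⟨i, -, hi⟩ := (mem_qry P n).1 hmem
    have h1 := slotW_lt_DD P n ht (Nat.lt_succ_iff.1 (List.mem_range.1 ha))
    have h2 := Wblk_le_winW P n t i
    have h3 := DD_le_Wblk P n
    omega
  obtain ⟨k1, k2⟩ := ocEval_oracles A (qry P n t) (slotW P n t) (List.range (RR P n + 1)) hnd hdis w
  have e : orcT P n t = (List.range (RR P n + 1)).map fun ℓ => RtOp.oracle (qry P n t ℓ) (slotW P n t ℓ) := rfl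
  refine ⟨fun ℓ hℓ => ?_, fun i hi => ?_⟩
  · rw [e, k1 ℓ (List.mem_range.2 (Nat.lt_succ_of_le hℓ))]
    simp [qry, List.map_map, Function.comp_def]
  · rw [e, k2 i (fun ℓ hℓ h => hi ℓ (Nat.lt_succ_iff.1 (List.mem_range.1 hℓ)) h.symm)]

end Queries

/-! ### The invariant and one round -/

section Round

/-- **The invariant after `t` rounds**: the data wires hold `x y (ansL t)`, the work wires of the
block are clear, the windows of the rounds `≥ t` are clear. [folklore] -/
structure St (t : ℕ) (w : ℕ → Bool) : Prop where
  /-- data wires -/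
  data : ∀ i < DD P n, w i = dFn P x y A t i
  /-- block work wires -/
  work : ∀ i, DD P n ≤ i → i < Wblk P n → w i = false
  /-- windows not yet written -/
  wins : ∀ t' i, t ≤ t' → t' < RR P n → i < RR P n → w (winW P n t' i) = false

variable {P x y A}

/-- **After the block**: data kept, the read-out of `word t` on the work wires. [folklore] -/
theorem clEval_blkC_of_st {t : ℕ} {w : ℕ → Bool} (hw : St P x y A t w) :
    clEval (blkC P n) w = fun i =>
      if i < Wblk P n then (if i < DD P n then dFn P x y A t i else readOut P.e P.Mtm (nT P n) (word P x y A t) i)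
      else w i := by
  rw [clEval_blkC P (dL P x y A t) (length_dL P x y A t) w (fun i hi => by rw [hw.data i hi, getD_dL P x y A hi]) hw.work,
    simFn_dL]
  funext i
  split_ifs with h1 h2
  · exact getD_dL P x y A h2
  · rfl
  · rfl

/-- After the block, the result wire of a cell inside the word reads that bit. [folklore] -/
theorem clEval_blkC_fW_of_st {t : ℕ} {w : ℕ → Bool} (hw : St P x y A t w) {k : ℕ} (hk : k < (word P x y A t).length) :
    clEval (blkC P n) w (fW P n k) = (word P x y A t)[k] := by
  have e := simFn_dL P x y A t
  have hkJ : k < JJ P.e P.Mtm (nT P n) := by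
    have := length_simFn_lt_JJ P (dL P x y A t) (length_dL P x y A t); rw [e] at this; omega
  rw [clEval_blkC_of_st hw]
  simp only
  rw [if_pos (fW_lt_Wblk P n hkJ), if_neg (not_lt.2 (DD_le_fW P n k))]
  have h := readOut_fW P (dL P x y A t) (length_dL P x y A t) (k := k) (by rw [e]; exact hk)
  simp only [e] at h
  exact h

/-- After the block, the result wire of a field cell reads the field bit. [folklore] -/
theorem clEval_blkC_fW_field {t : ℕ} {w : ℕ → Bool} (hw : St P x y A t w) {s i : ℕ} (hs : s < RR P n) (hi : i < RR P n) :
    clEval (blkC P n) w (fW P n (s * RR P n + i)) =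
      (OSim.padTo (RR P n) (OSim.qryσ P.M (xin P x y) (σP P x y A t) s)).getD i false := by
  have hk : s * RR P n + i < (word P x y A t).length := by
    have h1 : s * RR P n + i < RR P n * RR P n := by nlinarith
    exact lt_of_lt_of_le h1 (sq_le_length_word P x y A t)
  rw [clEval_blkC_fW_of_st hw hk, ← List.getD_eq_getElem _ false hk, getD_word_field P x y A t hs hi]

/-- **One round preserves the invariant.** [cite: BernsteinVazirani1997SICOMP, Thm. 8.3 (proof) with §8.3] -/
theorem st_roundOps {t : ℕ} (ht : t < RR P n) {w : ℕ → Bool} (hw : St P x y A t w) :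
    St P x y A (t + 1) (OSim.ocEval A (roundOps P n t) w) := by
  -- the four stages
  set w1 := clEval (blkC P n) w with hw1
  set w2 := clEval (copyC P n t) w1 with hw2
  set w3 := clEval (blkC P n) w2 with hw3
  have hsplit : OSim.ocEval A (roundOps P n t) w = OSim.ocEval A (orcT P n t) w3 := by
    rw [roundOps, OSim.ocEval_append, OSim.ocEval_append, OSim.ocEval_append, blk, OSim.ocEval_map_cl, OSim.ocEval_map_cl,
      OSim.ocEval_map_cl]
  rw [hsplit]
  -- stage 1: the block
  have e1 := clEval_blkC_of_st hw
  rw [← hw1] at e1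
  have hw1_hi : ∀ i, Wblk P n ≤ i → w1 i = w i := fun i hi => by rw [e1]; simp [not_lt.2 hi]
  have hw1_lo : ∀ i, i < DD P n → w1 i = w i := fun i hi => by
    rw [e1]; simp [lt_of_lt_of_le hi (DD_le_Wblk P n), hi, hw.data i hi]
  -- stage 2: the copy
  have hnd2 : ((copyPairs P n t).map Prod.snd).Nodup := by
    rw [copyPairs, List.map_map]
    refine List.nodup_range.map_on fun a ha b hb h => ?_
    exact (winW_inj P n (List.mem_range.1 ha) (List.mem_range.1 hb) h).2
  have hdis2 : ∀ p ∈ copyPairs P n t, ∀ q ∈ copyPairs P n t, q.2 ≠ p.1 := by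
    intro p hp q hq
    obtain ⟨i, hi, rfl⟩ := (mem_copyPairs P n).1 hp
    obtain ⟨j, hj, rfl⟩ := (mem_copyPairs P n).1 hq
    exact Nat.ne_of_gt (lt_of_lt_of_le (fW_lt_Wblk P n (field_lt_JJ P n ht hi)) (Wblk_le_winW P n t j))
  have hw2_win : ∀ i < RR P n, w2 (winW P n t i) =
      (OSim.padTo (RR P n) (OSim.qryσ P.M (xin P x y) (σP P x y A t) t)).getD i false := by
    intro i hi
    have h := clEval_copyOps_target (copyPairs P n t) hnd2 hdis2 w1 ((mem_copyPairs P n).2 ⟨i, hi, rfl⟩)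
    rw [copyC] at hw2
    rw [hw2, h, hw1_hi _ (Wblk_le_winW P n t i), hw.wins t i le_rfl ht hi, Bool.false_xor, hw1,
      clEval_blkC_fW_field hw ht hi]
  have hw2_else : ∀ i, (∀ j < RR P n, i ≠ winW P n t j) → w2 i = w1 i := by
    intro i hi
    rw [hw2, copyC, clEval_copyOps_of_ne]
    intro p hp
    obtain ⟨j, hj, rfl⟩ := (mem_copyPairs P n).1 hp
    exact fun e => hi j hj e.symm
  have hw2_lo : ∀ i, i < Wblk P n → w2 i = w1 i := fun i hi =>
    hw2_else i fun j _ e => absurd (Wblk_le_winW P n t j) (by rw [← e]; exact not_le.2 hi)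
  -- stage 3: the block again erases the word
  have e3 : w3 = fun i => if Wblk P n ≤ i then w2 i else w i := by
    have hinv : clEval (blkC P n) w1 = w := by rw [hw1]; exact clEval_blkC_blkC P w
    have step : clEval (blkC P n) (fun i => if Wblk P n ≤ i then w2 i else w1 i) =
        fun i => if Wblk P n ≤ i then w2 i else w i := by
      rw [clEval_blkC_ite, hinv]
    rw [hw3, ← step]
    congr 1
    funext i
    by_cases h : Wblk P n ≤ i
    · rw [if_pos h]
    · rw [if_neg h]; exact hw2_lo i (not_le.1 h)
  have hw3_lo : ∀ i, i < Wblk P n → w3 i = w i := fun i hi => by rw [e3]; simp [not_le.2 hi]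
  have hw3_hi : ∀ i, Wblk P n ≤ i → w3 i = w2 i := fun i hi => by rw [e3]; simp [hi]
  -- stage 4: the queries
  obtain ⟨k1, k2⟩ := ocEval_orcT P A ht w3
  have hslot_else : ∀ i, (∀ ℓ ≤ RR P n, i ≠ slotW P n t ℓ) → OSim.ocEval A (orcT P n t) w3 i = w3 i := k2
  refine ⟨fun i hi => ?_, fun i h1 h2 => ?_, fun t' i htt' ht' hi => ?_⟩
  · -- data wires
    by_cases hsl : ∃ ℓ ≤ RR P n, i = slotW P n t ℓ
    · obtain ⟨ℓ, hℓ, rfl⟩ := hsl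
      rw [k1 ℓ hℓ, hw3_lo _ (lt_of_lt_of_le hi (DD_le_Wblk P n)), hw.data _ hi, dFn_slotW, dFn_slotW,
        slotFn_of_le P x y A t (Nat.le_add_right _ _), Bool.false_xor, slotFn_succ_round P x y A t hℓ]
      congr 1
      have hwin : (List.range ℓ).map (fun i => w3 (winW P n t i)) =
          (List.range ℓ).map fun i => (OSim.padTo (RR P n) (OSim.qryσ P.M (xin P x y) (σP P x y A t) t)).getD i false := by
        refine List.map_congr_left fun i hi' => ?_
        have hiR : i < RR P n := lt_of_lt_of_le (List.mem_range.1 hi') hℓ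
        rw [hw3_hi _ (Wblk_le_winW P n t i), hw2_win i hiR]
      rw [hwin]
      -- `map getD (range ℓ) = take ℓ` on a list of length `R ≥ ℓ`
      apply List.ext_getElem
      · simpa using hℓ
      · intro j h1 h2
        rw [List.getElem_map, List.getElem_range, List.getElem_take, List.getD_eq_getElem]
    · push Not at hsl
      rw [hslot_else i (fun ℓ hℓ e => hsl ℓ hℓ e), hw3_lo _ (lt_of_lt_of_le hi (DD_le_Wblk P n)), hw.data i hi]
      -- `dFn (t+1) i = dFn t i` off the slots of round `t`
      by_cases hlt : i < n + qn P n
      · rw [dFn_of_lt P x y A hlt, dFn_of_lt P x y A hlt]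
      · rw [dFn_of_le P x y A (not_lt.1 hlt), dFn_of_le P x y A (not_lt.1 hlt), slotFn_succ_of_not]
        rintro ⟨ha, hb⟩
        refine hsl (i - (n + qn P n) - t * (RR P n + 1)) (by omega) ?_
        rw [slotW_eq]; omega
  · -- work wires
    rw [hslot_else i (fun ℓ hℓ e => absurd (slotW_lt_DD P n ht hℓ) (by rw [← e]; exact not_lt.2 h1)), hw3_lo i h2,
      hw.work i h1 h2]
  · -- later windows
    have hne_slot : ∀ ℓ ≤ RR P n, winW P n t' i ≠ slotW P n t ℓ := fun ℓ hℓ e => by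
      have a1 := slotW_lt_DD P n ht hℓ; have a2 := Wblk_le_winW P n t' i; have a3 := DD_le_Wblk P n; omega
    rw [hslot_else _ hne_slot, hw3_hi _ (Wblk_le_winW P n t' i),
      hw2_else _ (fun j hj e => absurd (winW_inj P n hi hj e).1 (by omega)), hw1_hi _ (Wblk_le_winW P n t' i)]
    exact hw.wins t' i (Nat.le_of_succ_le htt') ht' hi

end Round

/-! ### All rounds -/

section Run

/-- The initial assignment `x y 0 0 …` (the extension by zeros of `coinInput x y`). [folklore] -/
def w₀ : ℕ → Bool := liftW (coinInput (m := mW P n) x y)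

/-- The initial assignment is the string assignment of `x ++ y`. [folklore] -/
theorem w₀_apply (i : ℕ) : w₀ P x y i = (List.ofFn x ++ List.ofFn y).getD i false := by
  unfold w₀ liftW
  by_cases hi : i < NW P n
  · rw [dif_pos hi]
    by_cases h1 : i < n
    · have e : (⟨i, hi⟩ : Fin (NW P n)) = Fin.castAdd (qn P n + mW P n) ⟨i, h1⟩ := rfl
      rw [e, coinInput_castAdd, List.getD_append _ _ _ _ (by simpa using h1), List.getD_eq_getElem _ _ (by simpa using h1),
        List.getElem_ofFn]
    · by_cases h2 : i < n + qn P n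
      · have e : (⟨i, hi⟩ : Fin (NW P n)) = coinWire n (qn P n) (mW P n) ⟨i - n, by omega⟩ := by
          apply Fin.ext; simp [coinWire]; omega
        rw [e, coinInput_coinWire, List.getD_append_right _ _ _ _ (by simp; omega), List.length_ofFn,
          List.getD_eq_getElem _ _ (by simp; omega), List.getElem_ofFn]
      · have e : (⟨i, hi⟩ : Fin (NW P n)) = Fin.natAdd n (Fin.natAdd (qn P n) ⟨i - n - qn P n, by
            have := hi; dsimp only [NW] at this; omega⟩) := by
          apply Fin.ext; simp; omega
        rw [e, coinInput_work, List.getD_eq_default _ _ (by simp; omega)]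
  · rw [dif_neg hi, List.getD_eq_default _ _ (by simp; dsimp only [NW] at hi; omega)]

/-- **The invariant holds initially.** [folklore] -/
theorem st_zero : St P x y A 0 (w₀ P x y) := by
  have hl : (List.ofFn x ++ List.ofFn y).length = n + qn P n := by simp
  refine ⟨fun i _ => ?_, fun i h1 _ => ?_, fun t' i _ _ _ => ?_⟩
  · rw [w₀_apply]
    by_cases h : i < n + qn P n
    · rw [dFn_of_lt P x y A h]
    · rw [dFn_of_le P x y A (not_lt.1 h), List.getD_eq_default _ _ (by rw [hl]; omega)]; rfl
  · rw [w₀_apply, List.getD_eq_default _ _ (by rw [hl]; unfold DD at h1; omega)]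
  · rw [w₀_apply, List.getD_eq_default _ _ (by
      rw [hl]; have := Wblk_le_winW P n t' i; have := DD_le_Wblk P n; unfold DD at *; omega)]

/-- **After the first `t ≤ R` rounds the invariant holds.** [cite: BernsteinVazirani1997SICOMP, Thm. 8.3 (proof) with §8.3] -/
theorem st_rounds : ∀ {t : ℕ} (_ : t ≤ RR P n),
    St P x y A t (OSim.ocEval A ((List.range t).flatMap (roundOps P n)) (w₀ P x y))
  | 0, _ => st_zero P x y A
  | t + 1, ht => by
    rw [List.range_succ, List.flatMap_append, List.flatMap_singleton, OSim.ocEval_append]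
    exact st_roundOps (Nat.lt_of_succ_le ht) (st_rounds (Nat.le_of_succ_le ht))

/-- The assignment after the `R` rounds. [folklore] -/
def wR : ℕ → Bool := OSim.ocEval A (rounds P n) (w₀ P x y)

/-- **After all rounds the invariant holds.** [folklore] -/
theorem st_wR : St P x y A (RR P n) (wR P x y A) := st_rounds P x y A le_rfl

/-! ### The finale: last block and output swaps -/

section Finale

/-- The assignment after the last block: data, and the last word on the result wires. [folklore] -/
def wB : ℕ → Bool := clEval (blkC P n) (wR P x y A)

/-- **The final assignment** of the classical part. [folklore] -/
def wF : ℕ → Bool := OSim.ocEval A (body P n) (w₀ P x y)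

/-- The final assignment is the swap layer applied after the last block. [folklore] -/
theorem wF_eq : wF P x y A = clEval (swapsC P n) (wB P x y A) := by
  rw [wF, body, OSim.ocEval_append, fin, OSim.ocEval_append, blk, OSim.ocEval_map_cl, OSim.ocEval_map_cl]; rfl

/-- The swap pairs have distinct first components. [folklore] -/
theorem nodup_swapPairs_fst : ((swapPairs P n).map Prod.fst).Nodup := by
  rw [swapPairs, List.map_map]; simpa [Function.comp_def] using List.nodup_range

/-- The swap pairs have distinct second components. [folklore] -/
theorem nodup_swapPairs_snd : ((swapPairs P n).map Prod.snd).Nodup := by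
  rw [swapPairs, List.map_map]
  refine List.nodup_range.map_on fun a _ b _ h => ?_
  have := fW_inj P n h; omega

/-- No front wire is a result wire. [folklore] -/
theorem swapPairs_fst_ne_snd : ∀ p ∈ swapPairs P n, ∀ q ∈ swapPairs P n, p.1 ≠ q.2 := by
  intro p hp q hq
  obtain ⟨j, hj, rfl⟩ := (mem_swapPairs P n).1 hp
  obtain ⟨j', -, rfl⟩ := (mem_swapPairs P n).1 hq
  exact Nat.ne_of_lt (lt_fW_of_lt_JF P n hj _)

/-- **Front wire `j < JF` receives the result wire of cell `R² + j`.** [folklore] -/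
theorem wF_front {j : ℕ} (hj : j < JF P n) : wF P x y A j = wB P x y A (fW P n (RR P n * RR P n + j)) := by
  rw [wF_eq]
  exact (RevMux.clEval_swapOps _ (nodup_swapPairs_fst P) (nodup_swapPairs_snd P) (swapPairs_fst_ne_snd P) _).2.1 _
    ((mem_swapPairs P n).2 ⟨j, hj, rfl⟩)

/-- **The result wire of cell `R² + j` receives front wire `j`.** [folklore] -/
theorem wF_res {j : ℕ} (hj : j < JF P n) : wF P x y A (fW P n (RR P n * RR P n + j)) = wB P x y A j := by
  rw [wF_eq]
  exact (RevMux.clEval_swapOps _ (nodup_swapPairs_fst P) (nodup_swapPairs_snd P) (swapPairs_fst_ne_snd P) _).1 _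
    ((mem_swapPairs P n).2 ⟨j, hj, rfl⟩)

/-- Data wires outside the front window are not moved. [folklore] -/
theorem wF_of_JF_le {i : ℕ} (h1 : JF P n ≤ i) (h2 : i < DD P n) : wF P x y A i = wB P x y A i := by
  rw [wF_eq]
  refine RevMux.clEval_swapOps_of_forall_ne _ _ fun p hp => ?_
  obtain ⟨j, hj, rfl⟩ := (mem_swapPairs P n).1 hp
  exact ⟨by simp only; omega, Nat.ne_of_lt (lt_fW_of_lt_DD P n h2 _)⟩

/-- After the last block the data wires still hold input and coins. [folklore] -/
theorem wB_of_lt {i : ℕ} (hi : i < n + qn P n) : wB P x y A i = (List.ofFn x ++ List.ofFn y).getD i false := by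
  have hiD : i < DD P n := by unfold DD; omega
  rw [wB, clEval_blkC_of_st (st_wR P x y A)]
  simp only
  rw [if_pos (lt_of_lt_of_le hiD (DD_le_Wblk P n)), if_pos hiD, dFn_of_lt P x y A hi]

/-- After the last block the result wires inside the last word hold its bits. [folklore] -/
theorem wB_fW {k : ℕ} (hk : k < (word P x y A (RR P n)).length) : wB P x y A (fW P n k) = (word P x y A (RR P n))[k] :=
  clEval_blkC_fW_of_st (st_wR P x y A) hk

/-- The last word fits below `JJ = R² + JF`. [folklore] -/
theorem length_word_lt : (word P x y A (RR P n)).length < RR P n * RR P n + JF P n := by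
  rw [sq_add_JF, ← simFn_dL]
  exact length_simFn_lt_JJ P _ (length_dL P x y A _)

end Finale

/-! ### The output labels -/

section Out

/-- **The output label** of the classical part on `|x⟩|y⟩|0…0⟩`, relative to `A`. [cite: BernsteinVazirani1997SICOMP, Thm. 8.3 (proof) with §8.3] -/
def out : QReg (NW P n) := fun p => wF P x y A p

/-- **The classical part maps `|x y 0…0⟩` to `|out⟩`.** [cite: BernsteinVazirani1997SICOMP, Thm. 8.3 (proof) with §8.3] -/
theorem Dc_mulVec_coinInput : (Dc P n).toMatrix A *ᵥ basisState (coinInput x y) = basisState (out P x y A) :=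
  Dc_mulVec_basisState P n A _

/-- **The genuine output is a prefix of the read-out**: if the genuine run of `M` on `⟨x, y⟩` with
the oracle of `A` has `m < R` query rounds, all with queries of length `≤ R`, and outputs `b`, then
`b` is a prefix of `ofFn out`. [cite: BernsteinVazirani1997SICOMP, Thm. 8.3 (proof) with §8.3] -/
theorem out_prefix {m : ℕ} {b : List Bool} (hrun : OSim.RunShape P.M A (xin P x y) m b) (hmR : m < RR P n)
    (hQ : ∀ s < m, (OSim.gq P.M (xin P x y) A s).length ≤ RR P n) : b <+: List.ofFn (out P x y A) := by
  have hw := word_RR P x y A hrun hmR hQ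
  have hlenF : (OSim.fieldsσ P.M (xin P x y) (σP P x y A (RR P n)) (RR P n) (RR P n)).length = RR P n * RR P n :=
    OSim.length_fieldsσ _ _ _ _ _
  have hlen : (word P x y A (RR P n)).length = RR P n * RR P n + b.length := by rw [hw, List.length_append, hlenF]
  have hbJ : b.length ≤ JF P n := by have := length_word_lt P x y A; omega
  have hJN : JF P n ≤ NW P n := le_trans (JF_le_NN P n) (le_trans (NN_le_Wblk P n) (Wblk_le_NW P n))
  refine List.prefix_iff_eq_take.2 ?_
  symm
  apply List.ext_getElem
  · rw [List.length_take, List.length_ofFn, Nat.min_eq_left (le_trans hbJ hJN)]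
  · intro j h1 h2
    have hj : j < b.length := by simpa using h2
    rw [List.getElem_take, List.getElem_ofFn]
    change wF P x y A j = b[j]
    rw [wF_front P x y A (lt_of_lt_of_le hj hbJ), wB_fW P x y A (by rw [hlen]; omega)]
    simp only [hw]
    rw [List.getElem_append_right (by rw [hlenF]; omega)]
    simp [hlenF]

/-- The final position of coin `j`: moved to the result wire of cell `R² + (n + j)` if it was in
the front window, else still at wire `n + j`. [folklore] -/
def coinPos (j : ℕ) : ℕ := if n + j < JF P n then fW P n (RR P n * RR P n + (n + j)) else n + j

/-- The final position of a coin is a wire of the register. [folklore] -/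
theorem coinPos_lt {j : ℕ} (hj : j < qn P n) : coinPos P (n := n) j < NW P n := by
  unfold coinPos
  split_ifs with h
  · exact lt_of_lt_of_le (fW_lt_Wblk P n (out_lt_JJ P n h)) (Wblk_le_NW P n)
  · dsimp only [NW]; omega

/-- **The coins can be read off the output**: coin `j` sits at `coinPos j`. [folklore] -/
theorem out_coinPos (j : Fin (qn P n)) : out P x y A ⟨coinPos P j, coinPos_lt P j.isLt⟩ = y j := by
  have hget : (List.ofFn x ++ List.ofFn y).getD (n + j) false = y j := by
    rw [List.getD_append_right _ _ _ _ (by simp), List.length_ofFn, Nat.add_sub_cancel_left,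
      List.getD_eq_getElem _ _ (by simp), List.getElem_ofFn]
  change wF P x y A (coinPos P j) = y j
  unfold coinPos
  split_ifs with h
  · rw [wF_res P x y A h, wB_of_lt P x y A (by omega), hget]
  · rw [wF_of_JF_le P x y A (not_lt.1 h) (by unfold DD; omega), wB_of_lt P x y A (by omega), hget]

/-- **The output is injective in the coins.** [cite: BernsteinVazirani1997SICOMP, Thm. 8.3 (proof)] -/
theorem out_injective : Function.Injective fun y : QReg (qn P n) => out P x y A := by
  intro y₁ y₂ h
  funext j
  have h1 := out_coinPos P x y₁ A j
  have h2 := out_coinPos P x y₂ A j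
  rw [← h1, ← h2]
  exact congrFun h _

end Out

end Run

end OCoin

end Literature.Computability.QuantumComplexity

end
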